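import Summits.Ventures.PercRepro.Partition

/-!
# PercRepro — the 1-sum of two marked multigraphs along a bridge (p1, gen 4; proofs/P1-bridge-lemma.md §1)

`G₁.bridgeSum G₂ h₁ h₂` is the multigraph on `V₁ ⊕ V₂` with edges `E₁ ⊕ (E₂ ⊕ Unit)`: the edges of `G₁`, the
edges of `G₂`, and one new edge — the BRIDGE — from `inl h₁` to `inr h₂`.  A configuration splits into its two
halves and the bridge bit (`leftCfg`, `rightCfg`, `bridgeBit`; `glue` assembles them), and connectivity is read
off the halves: two left vertices are connected iff they are connected in `G₁` (`conn_inl_inl_iff`), a left and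
a right vertex iff the bridge is open and each is connected to its end of the bridge (`conn_inl_inr_iff`).
-/

namespace PercRepro

namespace MultiGraph

variable {V₁ E₁ V₂ E₂ : Type*}

/-- The 1-sum of `G₁` and `G₂` along a new bridge `inl h₁ — inr h₂`. -/
def bridgeSum (G₁ : MultiGraph V₁ E₁) (G₂ : MultiGraph V₂ E₂) (h₁ : V₁) (h₂ : V₂) :
    MultiGraph (V₁ ⊕ V₂) (E₁ ⊕ (E₂ ⊕ Unit)) where
  fst := Sum.elim (fun e => Sum.inl (G₁.fst e)) (Sum.elim (fun e => Sum.inr (G₂.fst e)) fun _ => Sum.inl h₁)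
  snd := Sum.elim (fun e => Sum.inl (G₁.snd e)) (Sum.elim (fun e => Sum.inr (G₂.snd e)) fun _ => Sum.inr h₂)

/-- The left half of a configuration of the 1-sum. -/
def leftCfg (ω : Config (E₁ ⊕ (E₂ ⊕ Unit))) : Config E₁ := fun e => ω (Sum.inl e)

/-- The right half of a configuration of the 1-sum. -/
def rightCfg (ω : Config (E₁ ⊕ (E₂ ⊕ Unit))) : Config E₂ := fun e => ω (Sum.inr (Sum.inl e))

/-- The bridge bit of a configuration of the 1-sum. -/
def bridgeBit (ω : Config (E₁ ⊕ (E₂ ⊕ Unit))) : Bool := ω (Sum.inr (Sum.inr ()))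

/-- Assemble a configuration of the 1-sum from its two halves and the bridge bit. -/
def glue (ω₁ : Config E₁) (ω₂ : Config E₂) (β : Bool) : Config (E₁ ⊕ (E₂ ⊕ Unit)) :=
  Sum.elim ω₁ (Sum.elim ω₂ fun _ => β)

/-- The left half of a gluing. -/
@[simp] theorem leftCfg_glue (ω₁ : Config E₁) (ω₂ : Config E₂) (β : Bool) : leftCfg (glue ω₁ ω₂ β) = ω₁ := rfl

/-- The right half of a gluing. -/
@[simp] theorem rightCfg_glue (ω₁ : Config E₁) (ω₂ : Config E₂) (β : Bool) : rightCfg (glue ω₁ ω₂ β) = ω₂ := rfl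

/-- The bridge bit of a gluing. -/
@[simp] theorem bridgeBit_glue (ω₁ : Config E₁) (ω₂ : Config E₂) (β : Bool) : bridgeBit (glue ω₁ ω₂ β) = β := rfl

/-- Every configuration is the gluing of its parts. -/
theorem glue_parts (ω : Config (E₁ ⊕ (E₂ ⊕ Unit))) : glue (leftCfg ω) (rightCfg ω) (bridgeBit ω) = ω := by
  funext e
  rcases e with e | e | e
  · rfl
  · rfl
  · rfl

/-- The complement of a gluing is the gluing of the complements with the bridge bit flipped. -/
theorem compl_glue (ω₁ : Config E₁) (ω₂ : Config E₂) (β : Bool) : (glue ω₁ ω₂ β)ᶜ = glue ω₁ᶜ ω₂ᶜ (!β) := by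
  funext e
  rcases e with e | e | e
  · rfl
  · rfl
  · rfl

variable (G₁ : MultiGraph V₁ E₁) (G₂ : MultiGraph V₂ E₂) (h₁ : V₁) (h₂ : V₂)

/-- A left path lifts to the 1-sum. -/
theorem conn_inl_of_conn {ω : Config (E₁ ⊕ (E₂ ⊕ Unit))} {x y : V₁} (h : G₁.Conn (leftCfg ω) x y) :
    (G₁.bridgeSum G₂ h₁ h₂).Conn ω (Sum.inl x) (Sum.inl y) := by
  refine Conn.induction (motive := fun z => (G₁.bridgeSum G₂ h₁ h₂).Conn ω (Sum.inl x) (Sum.inl z))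
    (Conn.refl _ ω _) (fun {a b} _ hab ha => ?_) h
  obtain ⟨e, he, hend⟩ := hab
  refine ha.trans (Conn.of_openAdj ⟨Sum.inl e, he, ?_⟩)
  rcases hend with ⟨h1, h2⟩ | ⟨h1, h2⟩
  · exact Or.inl ⟨by simp [bridgeSum, h1], by simp [bridgeSum, h2]⟩
  · exact Or.inr ⟨by simp [bridgeSum, h1], by simp [bridgeSum, h2]⟩

/-- A right path lifts to the 1-sum. -/
theorem conn_inr_of_conn {ω : Config (E₁ ⊕ (E₂ ⊕ Unit))} {x y : V₂} (h : G₂.Conn (rightCfg ω) x y) :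
    (G₁.bridgeSum G₂ h₁ h₂).Conn ω (Sum.inr x) (Sum.inr y) := by
  refine Conn.induction (motive := fun z => (G₁.bridgeSum G₂ h₁ h₂).Conn ω (Sum.inr x) (Sum.inr z))
    (Conn.refl _ ω _) (fun {a b} _ hab ha => ?_) h
  obtain ⟨e, he, hend⟩ := hab
  refine ha.trans (Conn.of_openAdj ⟨Sum.inr (Sum.inl e), he, ?_⟩)
  rcases hend with ⟨h1, h2⟩ | ⟨h1, h2⟩
  · exact Or.inl ⟨by simp [bridgeSum, h1], by simp [bridgeSum, h2]⟩
  · exact Or.inr ⟨by simp [bridgeSum, h1], by simp [bridgeSum, h2]⟩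

/-- The open bridge joins its two ends. -/
theorem conn_bridge {ω : Config (E₁ ⊕ (E₂ ⊕ Unit))} (hβ : bridgeBit ω = true) :
    (G₁.bridgeSum G₂ h₁ h₂).Conn ω (Sum.inl h₁) (Sum.inr h₂) :=
  Conn.of_openAdj ⟨Sum.inr (Sum.inr ()), hβ, Or.inl ⟨rfl, rfl⟩⟩

/-- **Connectivity from a left vertex in the 1-sum**: to a left vertex iff connected in `G₁`; to a right
vertex iff the bridge is open and both ends of the bridge are reached in their halves. -/
theorem conn_inl_iff (ω : Config (E₁ ⊕ (E₂ ⊕ Unit))) (x : V₁) (z : V₁ ⊕ V₂) :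
    (G₁.bridgeSum G₂ h₁ h₂).Conn ω (Sum.inl x) z ↔
      Sum.elim (fun z' => G₁.Conn (leftCfg ω) x z')
        (fun z' => bridgeBit ω = true ∧ G₁.Conn (leftCfg ω) x h₁ ∧ G₂.Conn (rightCfg ω) h₂ z') z := by
  constructor
  · intro h
    refine Conn.induction (motive := fun z => Sum.elim (fun z' => G₁.Conn (leftCfg ω) x z')
      (fun z' => bridgeBit ω = true ∧ G₁.Conn (leftCfg ω) x h₁ ∧ G₂.Conn (rightCfg ω) h₂ z') z)
      ?_ (fun {a b} _ hab ha => ?_) h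
    · exact Conn.refl G₁ (leftCfg ω) x
    obtain ⟨e, he, hend⟩ := hab
    rcases e with e | e | e
    · -- an edge of `G₁`
      rcases hend with ⟨rfl, rfl⟩ | ⟨rfl, rfl⟩
      · exact (ha : G₁.Conn (leftCfg ω) x (G₁.fst e)).trans (Conn.of_openAdj ⟨e, he, Or.inl ⟨rfl, rfl⟩⟩)
      · exact (ha : G₁.Conn (leftCfg ω) x (G₁.snd e)).trans (Conn.of_openAdj ⟨e, he, Or.inr ⟨rfl, rfl⟩⟩)
    · -- an edge of `G₂`
      rcases hend with ⟨rfl, rfl⟩ | ⟨rfl, rfl⟩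
      · obtain ⟨hβ, hx, hy⟩ := ha
        exact ⟨hβ, hx, hy.trans (Conn.of_openAdj ⟨e, he, Or.inl ⟨rfl, rfl⟩⟩)⟩
      · obtain ⟨hβ, hx, hy⟩ := ha
        exact ⟨hβ, hx, hy.trans (Conn.of_openAdj ⟨e, he, Or.inr ⟨rfl, rfl⟩⟩)⟩
    · -- the bridge
      rcases hend with ⟨rfl, rfl⟩ | ⟨rfl, rfl⟩
      · exact ⟨he, ha, Conn.refl _ _ _⟩
      · exact ha.2.1
  · intro h
    rcases z with z | z
    · exact G₁.conn_inl_of_conn G₂ h₁ h₂ h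
    · obtain ⟨hβ, hx, hz⟩ := h
      exact (G₁.conn_inl_of_conn G₂ h₁ h₂ hx).trans ((G₁.conn_bridge G₂ h₁ h₂ hβ).trans
        (G₁.conn_inr_of_conn G₂ h₁ h₂ hz))

/-- Two left vertices are connected in the 1-sum iff they are connected in `G₁`. -/
theorem conn_inl_inl_iff (ω : Config (E₁ ⊕ (E₂ ⊕ Unit))) (x y : V₁) :
    (G₁.bridgeSum G₂ h₁ h₂).Conn ω (Sum.inl x) (Sum.inl y) ↔ G₁.Conn (leftCfg ω) x y :=
  G₁.conn_inl_iff G₂ h₁ h₂ ω x (Sum.inl y)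

/-- A left and a right vertex are connected in the 1-sum iff the bridge is open and each reaches its end. -/
theorem conn_inl_inr_iff (ω : Config (E₁ ⊕ (E₂ ⊕ Unit))) (x : V₁) (y : V₂) :
    (G₁.bridgeSum G₂ h₁ h₂).Conn ω (Sum.inl x) (Sum.inr y) ↔
      bridgeBit ω = true ∧ G₁.Conn (leftCfg ω) x h₁ ∧ G₂.Conn (rightCfg ω) h₂ y :=
  G₁.conn_inl_iff G₂ h₁ h₂ ω x (Sum.inr y)

/-- **Connectivity from a right vertex in the 1-sum.** -/
theorem conn_inr_iff (ω : Config (E₁ ⊕ (E₂ ⊕ Unit))) (x : V₂) (z : V₁ ⊕ V₂) :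
    (G₁.bridgeSum G₂ h₁ h₂).Conn ω (Sum.inr x) z ↔
      Sum.elim (fun z' => bridgeBit ω = true ∧ G₂.Conn (rightCfg ω) x h₂ ∧ G₁.Conn (leftCfg ω) h₁ z')
        (fun z' => G₂.Conn (rightCfg ω) x z') z := by
  constructor
  · intro h
    refine Conn.induction (motive := fun z => Sum.elim
      (fun z' => bridgeBit ω = true ∧ G₂.Conn (rightCfg ω) x h₂ ∧ G₁.Conn (leftCfg ω) h₁ z')
      (fun z' => G₂.Conn (rightCfg ω) x z') z) ?_ (fun {a b} _ hab ha => ?_) h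
    · exact Conn.refl G₂ (rightCfg ω) x
    obtain ⟨e, he, hend⟩ := hab
    rcases e with e | e | e
    · rcases hend with ⟨rfl, rfl⟩ | ⟨rfl, rfl⟩
      · obtain ⟨hβ, hx, hy⟩ := ha
        exact ⟨hβ, hx, hy.trans (Conn.of_openAdj ⟨e, he, Or.inl ⟨rfl, rfl⟩⟩)⟩
      · obtain ⟨hβ, hx, hy⟩ := ha
        exact ⟨hβ, hx, hy.trans (Conn.of_openAdj ⟨e, he, Or.inr ⟨rfl, rfl⟩⟩)⟩
    · rcases hend with ⟨rfl, rfl⟩ | ⟨rfl, rfl⟩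
      · exact (ha : G₂.Conn (rightCfg ω) x (G₂.fst e)).trans (Conn.of_openAdj ⟨e, he, Or.inl ⟨rfl, rfl⟩⟩)
      · exact (ha : G₂.Conn (rightCfg ω) x (G₂.snd e)).trans (Conn.of_openAdj ⟨e, he, Or.inr ⟨rfl, rfl⟩⟩)
    · rcases hend with ⟨rfl, rfl⟩ | ⟨rfl, rfl⟩
      · exact ha.2.1
      · exact ⟨he, ha, Conn.refl _ _ _⟩
  · intro h
    rcases z with z | z
    · obtain ⟨hβ, hx, hz⟩ := h
      exact (G₁.conn_inr_of_conn G₂ h₁ h₂ hx).trans ((G₁.conn_bridge G₂ h₁ h₂ hβ).symm.trans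
        (G₁.conn_inl_of_conn G₂ h₁ h₂ hz))
    · exact G₁.conn_inr_of_conn G₂ h₁ h₂ h

/-- Two right vertices are connected in the 1-sum iff they are connected in `G₂`. -/
theorem conn_inr_inr_iff (ω : Config (E₁ ⊕ (E₂ ⊕ Unit))) (x y : V₂) :
    (G₁.bridgeSum G₂ h₁ h₂).Conn ω (Sum.inr x) (Sum.inr y) ↔ G₂.Conn (rightCfg ω) x y :=
  G₁.conn_inr_iff G₂ h₁ h₂ ω x (Sum.inr y)

end MultiGraph

end PercRepro
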